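import Literature.NumberTheory.Transcendental.YoshinagaBoundedVolume
import Literature.NumberTheory.Transcendental.SemialgebraicTraceElementary
import Literature.NumberTheory.Transcendental.FiniteVolumeComputable
import HarnessLib

/-!
# Finite-volume semialgebraic sets: elementary volume from tail decay (Yoshinaga's Thm. 18, route B)

Yoshinaga's theorem [Yoshinaga 2008, arXiv:0805.0349, Thm. 18] — every real Kontsevich–Zagier period
is an *elementary* real number (the tree's named fact
`Literature.NumberTheory.Transcendental.isElementaryReal_of_isRealPeriod`) — concerns integrals
`∫_σ p/q` whose domain and integrand may be unbounded.  The printed proof first makes both bounded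
(Lemma 24: Belkale–Brosnan + Hironaka's rectilinearization), and the tree proves everything
downstream of that step (`YoshinagaBoundedVolume.lean`, `SemialgebraicVolumeElementary.lean`:
`isElementaryReal_of_isRealPeriod_of_lemma24`, `…_of_boundedReduction`,
`…_of_boundedRepresentation`, `…_of_volume_reduction`).

This file is the *elementary* counterpart of `FiniteVolumeComputable.lean` (which treats
computability): it records the second, resolution-free route.  By "the integral is the area under
the graph" a real period is `vol(E₊) − vol(E₋)` for two `ℚ`-semialgebraic sets of *finite volume*
(`KZ.IntegralRep.exists_value_eq_volume_sub`), and for such a set `E ⊆ ℝ^m` the truncations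
`E ∩ [−ρ, ρ)^m` are approximated by normalised lattice counts with the explicit discrepancy
`m (s + 2) (2ρ)^m / N` of `YoshinagaLatticeDiscrepancy.lean` (`s` = the sum of the degrees of a
sign-condition presentation of `E`, uniformly in `ρ`), while the count
`n ↦ #{K ∈ [0, 2ρ(n)N(n))^m ∩ ℤ^m : K/N(n) − ρ(n) ∈ E}` is Kalmár elementary in `n` whenever the
radius `ρ` and the mesh `N` are (`Yoshinaga.elementaryRec_latticeCount_of_isSemialgebraic`: the
coordinates of the lattice points are *coded* functions of `(n, K)` in the sense of
`SemialgebraicTraceElementary.lean`, and membership of coded points in a fixed `ℚ`-semialgebraic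
set is an elementary predicate, `IsSemialgebraic.elementaryRec_ite_mem_of_isCoded`).  Hence
`vol E` is an elementary real as soon as the *tail* `vol(E ∖ [−ρ(n), ρ(n))^m)` is `≤ 1/(2(n+1))`
along an elementary sequence of radii (`Yoshinaga.isElementaryReal_volume_of_tailSeq`), in
particular as soon as `vol(E ∖ B(0, R)) ≤ C R^{−a}` for some `a > 0`
(`Yoshinaga.isElementaryReal_volume_of_tailDecay`, radii `ρ(n) = D (n+1)^K`).  That tail estimate
is a theorem of tame integration theory — `R ↦ vol(E ∖ B(0, R))` is a constructible function
[Cluckers–Miller 2011, Thm. 1.3] tending to `0`, hence `≤ R^{−r}` for large `R` [Cluckers–Miller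
2011, Prop. 1.5] — whose proof rests on the Lion–Rolin preparation theorem, a theory not in the
tree; exactly as in `FiniteVolumeComputable.lean` it enters as the explicit hypothesis `H` of the
final theorems (same statement, so that one input closes both Yoshinaga facts) and is NOT vendored
as a named fact (D-0026).

## Main statements

* `IsCoded.aeval_of_forall`, `IsSemialgebraic.elementaryRec_ite_mem_of_isCoded` — membership of a
  coded point `(n, K) ↦ P(n, K) ∈ ℝ^M` in a fixed `ℚ`-semialgebraic set is an elementary predicate.
* `Yoshinaga.LineTame.inter_box`, `Yoshinaga.latticeCount_inter_box` — truncation by a box costs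
  two points per line and does not change the lattice count.
* `Yoshinaga.elementaryRec_latticeCount_of_isSemialgebraic` — the lattice count with elementary
  radius and mesh is elementary.
* `Yoshinaga.isElementaryReal_volume_of_tailSeq`, `Yoshinaga.isElementaryReal_volume_of_tailDecay`
  — finite volume + effective tail ⇒ `vol E` is an elementary real.
* `KZ.IntegralRep.exists_value_eq_volume_sub`, `KZ.IntegralRep.isElementaryReal_value_of_tailDecay`,
  `isElementaryReal_of_isRealPeriod_of_tailDecay` — Yoshinaga's Thm. 18 from the tail-decay
  theorem of Cluckers–Miller for finite-volume `ℚ`-semialgebraic sets, taken as hypothesis.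

## References

* M. Yoshinaga, *Periods and elementary real numbers*, arXiv:0805.0349 (2008), §3.1 Thm. 18, §3.2
  Lemma 24, §3.4 Lemma 26, §3.6 Lemma 29, Prop. 10.
* K. Tent, M. Ziegler, *Computable functions of reals*, Münster J. Math. 3 (2010), 43–66, Lemma
  4.1, Cor. 6.3, Cor. 6.4.
* R. Cluckers, D. J. Miller, *Stability under integration of sums of products of real globally
  subanalytic functions and their logarithms*, Duke Math. J. 156 (2011), 311–348
  (arXiv:0911.4373), Thm. 1.3, Prop. 1.5.
* J.-M. Lion, J.-P. Rolin, *Intégration des fonctions sous-analytiques et volumes des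
  sous-ensembles sous-analytiques*, Ann. Inst. Fourier 48 (1998), 755–767.
* M. Kontsevich, D. Zagier, *Periods* (2001), §1.1.

## Design notes

* No definitions and no named facts are introduced (theorems only).  The lattice, the discrepancy
  bound and the sign-cell presentation are those of `YoshinagaLatticeDiscrepancy.lean` /
  `YoshinagaBoundedVolume.lean`; the coding of rational points is that of
  `SemialgebraicTraceElementary.lean`; the subgraph passage is `KZ.IntegralRep.volume_subgraph_eq`
  of `BoundedPeriodComputable.lean`.
* The hypothesis `H` of the last two theorems is verbatim that of
  `isComputableReal_of_isRealPeriod_of_tailDecay` (`FiniteVolumeComputable.lean`).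
-/

noncomputable section

open scoped Classical
open MeasureTheory Set Finset MvPolynomial Metric
open Literature.Computability.Complexity Literature.ModelTheory.ExponentialFields

namespace Literature.NumberTheory.Transcendental

/-! ### Coded points: membership in a fixed semialgebraic set is elementary -/

namespace IsCoded

variable {M : ℕ}

/-- The value of a rational polynomial at a point whose coordinates are coded functions of
`(n, K)` is a coded function (induction on the polynomial; `IsCoded.aeval` is the case of the
coded grid points). [cite: Yoshinaga2008, Lemma 26] -/
theorem aeval_of_forall {P : ℕ → ℕ → (Fin M → ℝ)} (hP : ∀ i, IsCoded fun n K => P n K i)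
    (p : MvPolynomial (Fin M) ℚ) : IsCoded fun n K => MvPolynomial.aeval (P n K) p := by
  induction p using MvPolynomial.induction_on with
  | C q => simpa using IsCoded.const q
  | add p q hp hq => simpa using hp.add hq
  | mul_X p i hp => simpa using hp.mul (hP i)

/-- A natural-number valued elementary function of the code is coded (`f = (f - 0)/(0 + 1)`).
[folklore] -/
theorem of_elementaryRec {f : ℕ → ℕ} (hf : ElementaryRec f) :
    IsCoded fun n K => (f (Nat.pair n K) : ℝ) :=
  ⟨f, fun _ => 0, fun _ => 0, hf, ElementaryRec.const 0, ElementaryRec.const 0, fun n K => by simp⟩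

end IsCoded

/-- **Membership of coded points in a `ℚ`-semialgebraic set is an elementary predicate**: if the
coordinates of `P(n, K) ∈ ℝ^M` are coded functions of `(n, K)`, then for every `ℚ`-semialgebraic
`D ⊆ ℝ^M` the indicator of `P(n, K) ∈ D` is a Kalmár elementary function of the code `⟨n, K⟩`
(induction over the generating Boolean algebra: sign conditions on coded functions are
elementary; Yoshinaga 2008, Lemma 26 / Tent–Ziegler 2010, Lemma 4.1 "the trace of semialgebraic
relations on `ℚ` is lower elementary"). [cite: Yoshinaga2008, Lemma 26] -/
theorem _root_.Literature.ModelTheory.ExponentialFields.IsSemialgebraic.elementaryRec_ite_mem_of_isCoded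
    {M : ℕ} {D : Set (Fin M → ℝ)} (hD : IsSemialgebraic ℚ D) {P : ℕ → ℕ → (Fin M → ℝ)}
    (hP : ∀ i, IsCoded fun n K => P n K i) :
    ElementaryRec fun c => if P c.unpair.1 c.unpair.2 ∈ D then 1 else 0 := by
  suffices H : ∀ s : Set (Fin M → ℝ), IsSemialgebraic ℚ s →
      ElementaryRec fun c => if P c.unpair.1 c.unpair.2 ∈ s then 1 else 0 from H D hD
  intro s hs
  induction hs using BooleanSubalgebra.closure_bot_sup_induction with
  | mem s hs =>
    rcases hs with ⟨p, rfl⟩ | ⟨p, rfl⟩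
    · exact (IsCoded.aeval_of_forall hP p).elementaryRec_ite_eq_zero.of_eq fun c => by
        by_cases hc : MvPolynomial.aeval (P c.unpair.1 c.unpair.2) p = 0 <;> simp [hc]
    · exact (IsCoded.aeval_of_forall hP p).elementaryRec_ite_pos.of_eq fun c => by
        by_cases hc : 0 < MvPolynomial.aeval (P c.unpair.1 c.unpair.2) p <;> simp [hc]
  | bot => exact (ElementaryRec.const 0).of_eq fun c => by simp
  | sup s _ t _ hs ht =>
    exact (ElementaryRec.ite_or hs ht).of_eq fun c => by
      by_cases h1 : P c.unpair.1 c.unpair.2 ∈ s <;>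
        by_cases h2 : P c.unpair.1 c.unpair.2 ∈ t <;>
          simp [h1, h2, Set.sup_eq_union]
  | compl s _ hs =>
    exact (ElementaryRec.ite_not hs).of_eq fun c => by
      by_cases h1 : P c.unpair.1 c.unpair.2 ∈ s <;> simp [h1]

namespace Yoshinaga

variable {m : ℕ}

/-! ### Truncation by a box -/

/-- **Truncation by a box costs two points per line**: if `A` is line-tame with bound `s`, then
`A ∩ [-r, r)^m` is line-tame with bound `s + 2` (add the two abscissae `±r` to the exceptional
set of each line). [folklore] -/
theorem LineTame.inter_box {s : ℕ} {A : Set (Fin m → ℝ)} (h : LineTame s A) (r : ℕ) :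
    LineTame (s + 2) (A ∩ box m r) := by
  intro k x
  obtain ⟨Z, hZ, hconst⟩ := h k x
  refine ⟨Z ∪ {-(r : ℝ), (r : ℝ)}, ?_, fun t₁ t₂ ht hZt => ?_⟩
  · exact (Finset.card_union_le _ _).trans (add_le_add hZ Finset.card_le_two)
  · have hA : Function.update x k t₁ ∈ A ↔ Function.update x k t₂ ∈ A :=
      hconst t₁ t₂ ht fun z hz => hZt z (Finset.mem_union_left _ hz)
    have h1 : -(r : ℝ) ∉ Icc t₁ t₂ := hZt _ (by simp)
    have h2 : (r : ℝ) ∉ Icc t₁ t₂ := hZt _ (by simp)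
    simp only [Set.mem_Icc, not_and, not_le] at h1 h2
    have hk : t₁ ∈ Ico (-(r : ℝ)) r ↔ t₂ ∈ Ico (-(r : ℝ)) r := by
      simp only [Set.mem_Ico]
      constructor
      · rintro ⟨ha, hb⟩
        exact ⟨ha.trans ht, h2 hb.le⟩
      · rintro ⟨ha, hb⟩
        refine ⟨?_, lt_of_le_of_lt ht hb⟩
        by_contra hcon
        rw [not_le] at hcon
        exact absurd (h1 hcon.le) (not_lt.2 ha)
    have hbox : Function.update x k t₁ ∈ box m r ↔ Function.update x k t₂ ∈ box m r := by
      rw [mem_box, mem_box]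
      constructor
      · intro hB i
        by_cases hi : i = k
        · subst hi
          simpa using hk.1 (by simpa using hB i)
        · simpa [Function.update_of_ne hi] using hB i
      · intro hB i
        by_cases hi : i = k
        · subst hi
          simpa using hk.2 (by simpa using hB i)
        · simpa [Function.update_of_ne hi] using hB i
    simp only [Set.mem_inter_iff]
    rw [hA, hbox]

/-- For `N ≥ 1` the lattice points of mesh `1/N` indexed by `K ∈ [0, 2rN)^m` lie in the box
`[-r, r)^m`. [folklore] -/
theorem latticePoint_mem_box {r N : ℕ} (hN : 0 < N) (K : Fin m → Fin (2 * r * N)) :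
    latticePoint r N (fun i => (K i : ℕ)) ∈ box m r := by
  rw [mem_box]
  intro i
  have hN' : (0 : ℝ) < N := by exact_mod_cast hN
  have hK : ((K i : ℕ) : ℝ) < 2 * r * N := by exact_mod_cast (K i).isLt
  have h0 : (0 : ℝ) ≤ ((K i : ℕ) : ℝ) / N := by positivity
  have h1 : ((K i : ℕ) : ℝ) / N < 2 * r := by
    rw [div_lt_iff₀ hN']
    linarith
  simp only [latticePoint, latticeCoord, Set.mem_Ico]
  constructor <;> linarith

/-- The lattice count only depends on the trace of the set on the lattice. [folklore] -/
theorem latticeCount_congr {r N : ℕ} {A B : Set (Fin m → ℝ)}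
    (h : ∀ K : Fin m → Fin (2 * r * N),
      latticePoint r N (fun i => (K i : ℕ)) ∈ A ↔ latticePoint r N (fun i => (K i : ℕ)) ∈ B) :
    latticeCount r N A = latticeCount r N B := by
  unfold latticeCount
  congr 1
  ext K
  simp only [Finset.mem_filter, Finset.mem_univ, true_and]
  exact h K

/-- **Truncation does not change the lattice count**: for `N ≥ 1`,
`latticeCount r N (A ∩ [-r, r)^m) = latticeCount r N A` (all lattice points lie in the box).
[folklore] -/
theorem latticeCount_inter_box {r N : ℕ} (hN : 0 < N) (A : Set (Fin m → ℝ)) :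
    latticeCount r N (A ∩ box m r) = latticeCount r N A :=
  latticeCount_congr fun K => by
    simp only [Set.mem_inter_iff, and_iff_left_iff_imp]
    exact fun _ => latticePoint_mem_box hN K

/-! ### The lattice count with elementary radius and mesh is elementary -/

/-- The coordinates of the lattice points `K/N(n) - ρ(n)`, `K` = the digits of the code `cd` in
base `2ρ(n)N(n)`, are coded functions of `(n, cd)` when `ρ` and `N ≥ 1` are elementary:
`(d - ρN)/((N - 1) + 1)`. [cite: Yoshinaga2008, Lemma 26] -/
theorem isCoded_latticePoint_digits {ρ ν : ℕ → ℕ} (hρ : ElementaryRec ρ) (hν : ElementaryRec ν)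
    (hν1 : ∀ n, 1 ≤ ν n) (i : Fin m) :
    IsCoded fun n cd => latticePoint (ρ n) (ν n) (digits (2 * ρ n * ν n) cd) i := by
  refine ⟨fun c => c.unpair.2 / (2 * ρ c.unpair.1 * ν c.unpair.1) ^ (i : ℕ) %
      (2 * ρ c.unpair.1 * ν c.unpair.1),
    fun c => ρ c.unpair.1 * ν c.unpair.1, fun c => ν c.unpair.1 - 1, ?_, ?_, ?_, fun n cd => ?_⟩
  · exact ElementaryRec.digit ElementaryRec.right
      (((ElementaryRec.const 2).mul' (hρ.comp ElementaryRec.left)).mul'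
        (hν.comp ElementaryRec.left)) i
  · exact (hρ.comp ElementaryRec.left).mul' (hν.comp ElementaryRec.left)
  · exact (hν.comp ElementaryRec.left).tsub' (ElementaryRec.const 1)
  · simp only [Nat.unpair_pair, latticePoint, latticeCoord, digits]
    have h1 : ((ν n - 1 : ℕ) : ℝ) + 1 = ν n := by
      rw [Nat.cast_sub (hν1 n), Nat.cast_one, sub_add_cancel]
    rw [h1]
    have hν' : (ν n : ℝ) ≠ 0 := by
      have := hν1 n
      positivity
    push_cast
    field_simp

/-- **The lattice count of a `ℚ`-semialgebraic set, with elementary radius `ρ(n)` and elementary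
mesh `1/N(n)` (`N ≥ 1`), is a Kalmár elementary function of `n`** (Yoshinaga 2008, Lemma 26 "the
function `n ↦ vol(V_n)` is elementary", lattice-point form, uniformly in the box): it is the
number of codes `cd < (2ρ(n)N(n))^m` whose lattice point lies in `E`, an elementary predicate of
`⟨n, cd⟩` by `IsSemialgebraic.elementaryRec_ite_mem_of_isCoded`. [cite: Yoshinaga2008, Lemma 26] -/
theorem elementaryRec_latticeCount_of_isSemialgebraic {E : Set (Fin m → ℝ)}
    (hE : IsSemialgebraic ℚ E) {ρ ν : ℕ → ℕ} (hρ : ElementaryRec ρ) (hν : ElementaryRec ν)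
    (hν1 : ∀ n, 1 ≤ ν n) : ElementaryRec fun n => latticeCount (ρ n) (ν n) E := by
  have hχ := hE.elementaryRec_ite_mem_of_isCoded
    (P := fun n cd => latticePoint (ρ n) (ν n) (digits (2 * ρ n * ν n) cd))
    (isCoded_latticePoint_digits hρ hν hν1)
  have hb : ElementaryRec fun n => (2 * ρ n * ν n) ^ m :=
    (((ElementaryRec.const 2).mul' hρ).mul' hν).pow' (ElementaryRec.const m)
  have hcount := ElementaryRec.card_filter_range
    (p := fun n cd => latticePoint (ρ n) (ν n) (digits (2 * ρ n * ν n) cd) ∈ E)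
    (hχ.of_eq fun c => by simp) hb
  refine hcount.of_eq fun n => ?_
  rw [latticeCount_eq_card_filter_range]

/-! ### Finite-volume sets with an effective tail have elementary volume -/

/-- **Exhaustion with an effective tail, elementary form.** Let `E ⊆ ℝ^m` be `ℚ`-semialgebraic
of finite volume and let `ρ ≥ 1` be an elementary sequence of box radii with
`vol(E ∖ [−ρ(n), ρ(n))^m) ≤ 1/(2(n+1))`.  Then `vol E` is an elementary real: with `s` the sum
of the degrees of a sign-condition presentation of `E` (`IsSemialgebraic.exists_eq_setOf_signVec_mem`,
`lineTame_signCell`), the truncation `E ∩ [−ρ(n), ρ(n))^m` is line-tame with bound `s + 2`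
(`LineTame.inter_box`), so its volume is within `m (s+2) (2ρ(n))^m / N ≤ 1/(2(n+1))` of the
normalised lattice count for the mesh `N(n) = 2(n+1) m (s+2) (2ρ(n))^m + 1`
(`abs_volumeReal_sub_latticeCount_div_le`), and that count is elementary in `n`
(`elementaryRec_latticeCount_of_isSemialgebraic`).  This is Yoshinaga's §3.4–3.6 run on the
exhaustion instead of on a bounded set. [cite: Yoshinaga2008, Lemma 29] -/
theorem isElementaryReal_volume_of_tailSeq {E : Set (Fin m → ℝ)} (hE : IsSemialgebraic ℚ E)
    (hfin : volume E ≠ ⊤) {ρ : ℕ → ℕ} (hρ : ElementaryRec ρ) (hρ1 : ∀ n, 1 ≤ ρ n)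
    (htail : ∀ n : ℕ, volume (E \ box m (ρ n)) ≤ ENNReal.ofReal (1 / (2 * ((n : ℝ) + 1)))) :
    IsElementaryReal (volume E).toReal := by
  -- sign-condition presentation and the line-tameness bound
  obtain ⟨Q, T, hEQ⟩ := hE.exists_eq_setOf_signVec_mem
  set F : Q → MvPolynomial (Fin m) ℚ := fun q => (q : MvPolynomial (Fin m) ℚ) with hF
  have hcell : signCell F T = E := by rw [hEQ]; rfl
  set s : ℕ := ∑ q, (F q).totalDegree with hs
  have hT : LineTame s E := hcell ▸ lineTame_signCell F T
  have hmeas : MeasurableSet E := IsSemialgebraic.measurableSet_holds hE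
  -- the mesh
  set ν : ℕ → ℕ := fun n => 2 * (n + 1) * (m * (s + 2) * (2 * ρ n) ^ m) + 1 with hν
  have eν : ElementaryRec ν :=
    ((((ElementaryRec.const 2).mul' (ElementaryRec.succ' ElementaryRec.id')).mul'
      ((ElementaryRec.const (m * (s + 2))).mul'
        (((ElementaryRec.const 2).mul' hρ).pow' (ElementaryRec.const m)))).succ').of_eq
      fun n => by simp [hν]
  have hν1 : ∀ n, 1 ≤ ν n := fun n => Nat.le_add_left 1 _
  refine ⟨fun n => latticeCount (ρ n) (ν n) E, fun _ => 0, fun n => ν n ^ m - 1,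
    elementaryRec_latticeCount_of_isSemialgebraic hE hρ eν hν1, ElementaryRec.const 0,
    (eν.pow' (ElementaryRec.const m)).tsub' (ElementaryRec.const 1), fun n => ?_⟩
  have hνpos : 0 < ν n := hν1 n
  have hνR : (0 : ℝ) < ν n := by exact_mod_cast hνpos
  have hcast : ((ν n ^ m - 1 : ℕ) : ℝ) + 1 = (ν n : ℝ) ^ m := by
    rw [Nat.cast_sub (Nat.one_le_pow _ _ hνpos), Nat.cast_pow, Nat.cast_one, sub_add_cancel]
  rw [hcast, Nat.cast_zero, sub_zero]
  -- the truncation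
  set A : Set (Fin m → ℝ) := E ∩ box m (ρ n) with hA
  have hAbox : A ⊆ box m (ρ n) := Set.inter_subset_right
  have hAmeas : MeasurableSet A := hmeas.inter measurableSet_box
  have hdisc := abs_volumeReal_sub_latticeCount_div_le (s := s + 2) hνpos (hρ1 n) m A hAmeas hAbox
    (hT.inter_box (ρ n))
  rw [hA, latticeCount_inter_box hνpos, ← hA] at hdisc
  -- the discrepancy is at most `1/(2(n+1))`
  have hn1 : (0 : ℝ) < 2 * ((n : ℝ) + 1) := by positivity
  have hX0 : (0 : ℝ) ≤ (m : ℝ) * ((s : ℝ) + 2) * (2 * (ρ n : ℝ)) ^ m := by positivity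
  have hνeq : (ν n : ℝ) = 2 * ((n : ℝ) + 1) * ((m : ℝ) * ((s : ℝ) + 2) * (2 * (ρ n : ℝ)) ^ m) + 1 := by
    simp only [hν]
    push_cast
    ring
  have hdisc' : (m : ℝ) * ((s + 2 : ℕ) : ℝ) * (2 * (ρ n : ℝ)) ^ m / (ν n : ℝ) ≤
      1 / (2 * ((n : ℝ) + 1)) := by
    rw [div_le_div_iff₀ hνR hn1, one_mul, hνeq]
    push_cast
    nlinarith
  -- the tail is at most `1/(2(n+1))`
  have hfinA : volume A ≠ ⊤ := measure_ne_top_of_subset Set.inter_subset_left hfin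
  have hfinT : volume (E \ box m (ρ n)) ≠ ⊤ := measure_ne_top_of_subset Set.sdiff_subset hfin
  have hsplit : (volume E).toReal = volume.real A + (volume (E \ box m (ρ n))).toReal := by
    rw [measureReal_def, ← ENNReal.toReal_add hfinA hfinT, hA, measure_inter_add_sdiff _ measurableSet_box]
  have htail' : (volume (E \ box m (ρ n))).toReal ≤ 1 / (2 * ((n : ℝ) + 1)) :=
    ENNReal.toReal_le_of_le_ofReal (by positivity) (htail n)
  have htail0 : 0 ≤ (volume (E \ box m (ρ n))).toReal := ENNReal.toReal_nonneg
  -- conclusion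
  have hhalf : 1 / (2 * ((n : ℝ) + 1)) + 1 / (2 * ((n : ℝ) + 1)) = 1 / ((n : ℝ) + 1) := by
    field_simp
    ring
  rw [hsplit]
  calc |volume.real A + (volume (E \ box m (ρ n))).toReal -
        (latticeCount (ρ n) (ν n) E : ℝ) / (ν n : ℝ) ^ m|
      = |(volume.real A - (latticeCount (ρ n) (ν n) E : ℝ) / (ν n : ℝ) ^ m) +
          (volume (E \ box m (ρ n))).toReal| := by ring_nf
    _ ≤ |volume.real A - (latticeCount (ρ n) (ν n) E : ℝ) / (ν n : ℝ) ^ m| +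
          |(volume (E \ box m (ρ n))).toReal| := abs_add_le _ _
    _ ≤ 1 / (2 * ((n : ℝ) + 1)) + 1 / (2 * ((n : ℝ) + 1)) := by
        refine add_le_add (hdisc.trans ?_) ?_
        · exact_mod_cast hdisc'
        · rw [abs_of_nonneg htail0]
          exact htail'
    _ = 1 / ((n : ℝ) + 1) := hhalf

/-- **Finite-volume `ℚ`-semialgebraic sets with polynomially decaying tails have elementary
volume.** If `E ⊆ ℝ^m` is `ℚ`-semialgebraic, `vol E < ∞` and `vol(E ∖ B(0, R)) ≤ C R^{−a}` for
`R ≥ 1` (`a > 0`; sup-norm balls), then `vol E` is an elementary real: take the radii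
`ρ(n) = D (n+1)^K` with `K a ≥ 1` and `C D^{−a} ≤ 1/2` in `isElementaryReal_volume_of_tailSeq`.
The tail hypothesis is a theorem of tame integration theory — `R ↦ vol(E ∖ B(0, R))` is a
constructible function of `R` [Cluckers–Miller 2011, Thm. 1.3] tending to `0`, hence `≤ R^{−r}`
for large `R` [Cluckers–Miller 2011, Prop. 1.5] — and is an explicit hypothesis here, not
vendored as a fact. [cite: Yoshinaga2008, Lemma 29] -/
theorem isElementaryReal_volume_of_tailDecay {E : Set (Fin m → ℝ)} (hE : IsSemialgebraic ℚ E)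
    (hfin : volume E ≠ ⊤) {C a : ℝ} (ha : 0 < a)
    (htail : ∀ R : ℝ, 1 ≤ R → volume (E \ Metric.ball 0 R) ≤ ENNReal.ofReal (C * R ^ (-a))) :
    IsElementaryReal (volume E).toReal := by
  -- a nonnegative constant
  set C' : ℝ := max C 0 with hC'
  have hC'0 : 0 ≤ C' := le_max_right _ _
  have htail' : ∀ R : ℝ, 1 ≤ R → volume (E \ Metric.ball 0 R) ≤ ENNReal.ofReal (C' * R ^ (-a)) :=
    fun R hR => (htail R hR).trans (ENNReal.ofReal_le_ofReal
      (mul_le_mul_of_nonneg_right (le_max_left _ _) (Real.rpow_nonneg (by linarith) _)))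
  -- the exponent `K` with `K a ≥ 1`
  set K : ℕ := ⌈1 / a⌉₊ with hK
  have hKa : 1 ≤ (K : ℝ) * a := by
    have h1 : 1 / a ≤ K := Nat.le_ceil _
    have := mul_le_mul_of_nonneg_right h1 ha.le
    rwa [one_div, inv_mul_cancel₀ ha.ne'] at this
  -- the factor `D` with `C' D^{-a} ≤ 1/2`
  set y : ℝ := (2 * C' + 2) ^ (1 / a) with hy
  have hy0 : 0 ≤ y := Real.rpow_nonneg (by linarith) _
  set D : ℕ := ⌈y⌉₊ + 1 with hD
  have hD1 : 1 ≤ D := Nat.le_add_left 1 _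
  have hyD : y ≤ D := by
    rw [hD]; push_cast
    exact (Nat.le_ceil y).trans (le_add_of_nonneg_right zero_le_one)
  have hDpos : (0 : ℝ) < D := by exact_mod_cast hD1
  have hDa : 2 * C' + 2 ≤ (D : ℝ) ^ a := by
    have h1 : y ^ a ≤ (D : ℝ) ^ a := Real.rpow_le_rpow hy0 hyD ha.le
    have h2 : y ^ a = 2 * C' + 2 := by
      rw [hy, ← Real.rpow_mul (by linarith), one_div, inv_mul_cancel₀ ha.ne', Real.rpow_one]
    linarith
  have hCD : C' * (D : ℝ) ^ (-a) ≤ 1 / 2 := by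
    rw [Real.rpow_neg hDpos.le, ← div_eq_mul_inv, div_le_iff₀ (Real.rpow_pos_of_pos hDpos a)]
    linarith
  -- the radii
  set ρ : ℕ → ℕ := fun n => D * (n + 1) ^ K with hρ
  have eρ : ElementaryRec ρ :=
    (ElementaryRec.const D).mul' ((ElementaryRec.succ' ElementaryRec.id').pow' (ElementaryRec.const K))
  have hρ1 : ∀ n, 1 ≤ ρ n := fun n => Nat.mul_pos hD1 (Nat.pow_pos (Nat.succ_pos n))
  have hρR : ∀ n, (1 : ℝ) ≤ ρ n := fun n => by exact_mod_cast hρ1 n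
  refine isElementaryReal_volume_of_tailSeq hE hfin eρ hρ1 fun n => ?_
  -- the box contains the ball
  have hsub : E \ box m (ρ n) ⊆ E \ Metric.ball 0 (ρ n) := by
    refine Set.sdiff_subset_sdiff_right fun z hz => ?_
    rw [Metric.mem_ball, dist_zero_right] at hz
    rw [mem_box]
    intro i
    have hi : |z i| < ρ n := lt_of_le_of_lt (by simpa using norm_le_pi_norm z i) hz
    rw [abs_lt] at hi
    exact ⟨hi.1.le, hi.2⟩
  refine (measure_mono hsub).trans ((htail' _ (hρR n)).trans (ENNReal.ofReal_le_ofReal ?_))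
  -- the rate: `C' ρ(n)^{-a} ≤ 1/(2(n+1))`
  have hn1 : (1 : ℝ) ≤ (n : ℝ) + 1 := by
    have : (0 : ℝ) ≤ n := Nat.cast_nonneg n
    linarith
  have hn0 : (0 : ℝ) < (n : ℝ) + 1 := by positivity
  have hρeq : ((ρ n : ℕ) : ℝ) = (D : ℝ) * ((n : ℝ) + 1) ^ ((K : ℕ) : ℝ) := by
    rw [Real.rpow_natCast]
    simp [hρ]
  have h2pos : (0 : ℝ) < ((n : ℝ) + 1) ^ ((K : ℕ) : ℝ) := Real.rpow_pos_of_pos hn0 _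
  rw [hρeq, Real.mul_rpow hDpos.le h2pos.le, ← Real.rpow_mul hn0.le, ← mul_assoc]
  have h3 : ((n : ℝ) + 1) ^ (((K : ℕ) : ℝ) * -a) ≤ 1 / ((n : ℝ) + 1) := by
    have : (1 : ℝ) / ((n : ℝ) + 1) = ((n : ℝ) + 1) ^ (-(1 : ℝ)) := by
      rw [Real.rpow_neg hn0.le, Real.rpow_one, one_div]
    rw [this]
    refine Real.rpow_le_rpow_of_exponent_le hn1 ?_
    nlinarith
  have h4 : (0 : ℝ) ≤ ((n : ℝ) + 1) ^ (((K : ℕ) : ℝ) * -a) := Real.rpow_nonneg hn0.le _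
  calc C' * (D : ℝ) ^ (-a) * ((n : ℝ) + 1) ^ (((K : ℕ) : ℝ) * -a)
      ≤ 1 / 2 * (1 / ((n : ℝ) + 1)) := mul_le_mul hCD h3 h4 (by norm_num)
    _ = 1 / (2 * ((n : ℝ) + 1)) := by rw [one_div_mul_one_div]

end Yoshinaga

/-! ### Periods: reduction of Yoshinaga's elementarity statement to tail decay -/

namespace KZ.IntegralRep

variable {n : ℕ}

/-- **An integral representation is a difference of two finite semialgebraic volumes**:
`r.value = vol(E₊) - vol(E₋)` for the strict subgraphs `E_± = {(x, t) | x ∈ σ, 0 < t < ±f x}`,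
which are `ℚ`-semialgebraic (graph elimination, Tarski–Seidenberg) of finite volume `∫_σ f^±`
("the integral of a function is the area under its graph", Kontsevich–Zagier 2001, §1.1; the
decomposition used inside `KZ.IntegralRep.isComputableReal_value_of_tailDecay`, recorded as a
lemma). [cite: KontsevichZagier2001, §1.1] -/
theorem exists_value_eq_volume_sub (r : IntegralRep n) :
    ∃ E₁ E₂ : Set (Fin (n + 1) → ℝ), IsSemialgebraic ℚ E₁ ∧ IsSemialgebraic ℚ E₂ ∧
      volume E₁ ≠ ⊤ ∧ volume E₂ ≠ ⊤ ∧ r.value = (volume E₁).toReal - (volume E₂).toReal := by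
  have hTS : Literature.ModelTheory.ExponentialFields.tarski_seidenberg_real (k := ℚ) :=
    Literature.ModelTheory.ExponentialFields.tarski_seidenberg_real_holds
  have hσm : MeasurableSet r.domain := IntegralRep.measurableSet_domain_holds r
  set E : ((Fin n → ℝ) → ℝ) → Set (Fin (n + 1) → ℝ) := fun g =>
    {v | Fin.init v ∈ r.domain ∧ 0 < v (Fin.last n) ∧ v (Fin.last n) < g (Fin.init v)} with hE
  have hT : IsSemialgebraic ℚ {u : Fin (n + 2) → ℝ |
      0 < u (Fin.castSucc (Fin.last n)) ∧
        u (Fin.castSucc (Fin.last n)) < u (Fin.last (n + 1))} := by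
    have h1 := isSemialgebraic_setOf_eval_pos (k := ℚ) (R := ℝ)
      (MvPolynomial.X (Fin.castSucc (Fin.last n)) : MvPolynomial (Fin (n + 2)) ℚ)
    have h2 := isSemialgebraic_setOf_eval_lt (k := ℚ) (R := ℝ)
      (MvPolynomial.X (Fin.castSucc (Fin.last n)) : MvPolynomial (Fin (n + 2)) ℚ)
      (MvPolynomial.X (Fin.last (n + 1)))
    convert h1.inter h2 using 1
    ext u
    simp [Set.mem_inter_iff]
  have hEsa : ∀ g, IsSemialgebraicFunOn ℚ r.domain g → IsSemialgebraic ℚ (E g) := by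
    intro g hg
    convert hg.isSemialgebraic_setOf_snoc_mem hTS hT using 1
    ext v
    simp [hE]
  have hEvol : ∀ g, IsSemialgebraicFunOn ℚ r.domain g → IntegrableOn g r.domain →
      volume (E g) = ENNReal.ofReal (∫ x in r.domain, max (g x) 0) := by
    intro g hg hgi
    rw [hE]
    exact volume_subgraph_eq hσm (hg.measurable_indicator_of_tarskiSeidenberg hTS hσm) hgi
  have hf := r.isSemialgebraicFunOn_integrand
  have hfi := r.integrableOn
  refine ⟨E r.integrand, E (-r.integrand), hEsa _ hf, hEsa _ hf.neg, ?_, ?_, ?_⟩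
  · rw [hEvol _ hf hfi]; exact ENNReal.ofReal_ne_top
  · rw [hEvol _ hf.neg hfi.neg]; exact ENNReal.ofReal_ne_top
  rw [hEvol _ hf hfi, hEvol _ hf.neg hfi.neg,
    ENNReal.toReal_ofReal (setIntegral_nonneg hσm fun x _ => le_max_right _ _),
    ENNReal.toReal_ofReal (setIntegral_nonneg hσm fun x _ => le_max_right _ _)]
  simp only [Pi.neg_apply]
  rw [← integral_sub hfi.pos_part hfi.neg_part, value]
  refine integral_congr_ae (Filter.Eventually.of_forall fun x => ?_)
  exact (max_zero_sub_max_neg_zero_eq_self (r.integrand x)).symm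

/-- **Integral representations are elementary, granted polynomial tail decay of finite-volume
`ℚ`-semialgebraic sets**: by `exists_value_eq_volume_sub`,
`Yoshinaga.isElementaryReal_volume_of_tailDecay` and closure of the elementary reals under
subtraction (Yoshinaga 2008, Prop. 10). [cite: Yoshinaga2008, Thm. 18] -/
theorem isElementaryReal_value_of_tailDecay (r : IntegralRep n)
    (H : ∀ (m : ℕ) (E : Set (Fin m → ℝ)), IsSemialgebraic ℚ E → volume E ≠ ⊤ →
      ∃ C a : ℝ, 0 < a ∧ ∀ R : ℝ, 1 ≤ R →
        volume (E \ Metric.ball 0 R) ≤ ENNReal.ofReal (C * R ^ (-a))) :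
    IsElementaryReal r.value := by
  obtain ⟨E₁, E₂, h₁, h₂, f₁, f₂, hval⟩ := r.exists_value_eq_volume_sub
  obtain ⟨C₁, a₁, ha₁, ht₁⟩ := H _ E₁ h₁ f₁
  obtain ⟨C₂, a₂, ha₂, ht₂⟩ := H _ E₂ h₂ f₂
  rw [hval]
  exact (Yoshinaga.isElementaryReal_volume_of_tailDecay h₁ f₁ ha₁ ht₁).sub
    (Yoshinaga.isElementaryReal_volume_of_tailDecay h₂ f₂ ha₂ ht₂)

end KZ.IntegralRep

/-- **Real periods are elementary, granted polynomial tail decay of finite-volume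
`ℚ`-semialgebraic sets** — a resolution-free route to Yoshinaga's theorem
`isElementaryReal_of_isRealPeriod` [Yoshinaga 2008, Thm. 18]: the printed proof (Lemma 24) first
makes the domain and the integrand bounded by Hironaka's rectilinearization; here instead the
period is exhausted by boxes with elementary lattice counts, and the only input not proved in the
tree is the tail estimate `vol(E ∖ B(0, R)) = O(R^{−a})` for `ℚ`-semialgebraic `E` of finite volume
— `R ↦ vol(E ∖ B(0, R))` is constructible by [Cluckers–Miller 2011, Thm. 1.3] and tends to `0`, so
[Cluckers–Miller 2011, Prop. 1.5: "Let `f` be in `C(X × ℝ)` … and suppose that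
`lim_{y→+∞} f(x,y) = 0` for all `x ∈ X`. Then there exist a constant `r > 0` and a subanalytic
function `g : X → (0,+∞)` such that `|f(x,y)| ≤ y^{−r}` for all `x ∈ X` and all `y` with
`y > g(x)`"] applies with `X` a point — taken as the explicit hypothesis `H` (all dimensions,
sup-norm balls; verbatim the hypothesis of `isComputableReal_of_isRealPeriod_of_tailDecay`) and
NOT vendored as a named fact (its proof needs the Lion–Rolin preparation theorem, a theory not in
the tree). [cite: Yoshinaga2008, Thm. 18] -/
theorem isElementaryReal_of_isRealPeriod_of_tailDecay
    (H : ∀ (m : ℕ) (E : Set (Fin m → ℝ)), IsSemialgebraic ℚ E → volume E ≠ ⊤ →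
      ∃ C a : ℝ, 0 < a ∧ ∀ R : ℝ, 1 ≤ R →
        volume (E \ Metric.ball 0 R) ≤ ENNReal.ofReal (C * R ^ (-a))) :
    isElementaryReal_of_isRealPeriod := by
  intro x hx
  obtain ⟨n, σ, p, q, hσ, hq, hint, rfl⟩ := hx
  have := (KZ.IntegralRep.ofRational σ p q hσ hq hint).isElementaryReal_value_of_tailDecay H
  rwa [KZ.IntegralRep.value_ofRational] at this

/-- The two resolution-free reductions agree: under the tail-decay hypothesis both Yoshinaga
facts of `PeriodConjecture.lean` hold (the computable one also directly, by
`isComputableReal_of_isRealPeriod_of_tailDecay`, or from the elementary one by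
`IsElementaryReal.isComputableReal_holds`). [cite: Yoshinaga2008, Thm. 18] -/
theorem isElementaryReal_and_isComputableReal_of_isRealPeriod_of_tailDecay
    (H : ∀ (m : ℕ) (E : Set (Fin m → ℝ)), IsSemialgebraic ℚ E → volume E ≠ ⊤ →
      ∃ C a : ℝ, 0 < a ∧ ∀ R : ℝ, 1 ≤ R →
        volume (E \ Metric.ball 0 R) ≤ ENNReal.ofReal (C * R ^ (-a))) :
    isElementaryReal_of_isRealPeriod ∧ isComputableReal_of_isRealPeriod :=
  ⟨isElementaryReal_of_isRealPeriod_of_tailDecay H, fun hx =>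
    IsElementaryReal.isComputableReal_holds (isElementaryReal_of_isRealPeriod_of_tailDecay H hx)⟩

end Literature.NumberTheory.Transcendental
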